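import Summits.QuantumFields.GaugeBoot.DiagonalRPTorusNegative
import Literature.MathematicalPhysics.QuantumFieldTheory.LatticeRPMechanism
import Literature.MathematicalPhysics.QuantumFieldTheory.StrongCouplingActivities
import Literature.MathematicalPhysics.QuantumLattice.BalabanRGSpreadTwist
import Literature.RepresentationTheory.CompactGroups.UnitaryTrick
import HarnessLib

/-!
# Diagonal RP on the two-dimensional torus, II: two-link Haar integrals and the bump
(gauge-boot, task L3(δ))

HONEST FRAMING (cell `pub-gaugeboot`, page 1 of every file): the venture produces certified bounds
on lattice expectations at stated coupling, gauge group, dimension and torus size; NOT a mass gap,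
NOT a continuum limit, NOT a string tension; NOT Yang–Mills-summit-bearing (barriers
`FixedCouplingUltralocality`, `PerturbativeInvisibility`). This module is part of a small NEGATIVE
result about which positivity constraints a TORUS certificate may use; it discharges nothing else.

Measure-theoretic groundwork for `DiagonalRPTorusNegativeTwo.lean`, on the product Haar
probability measure `linkMeasure L G` of the links of `(ℤ/L)²` (compact metrisable `G`): the
link-by-link change of variables `U_a ↦ U_a ψ(U)` (`integral_comp_update_mul`, from the tree's
`Literature.MathematicalPhysics.QuantumLattice.measurePreserving_update_mul_pi`), single-link
marginals, independence of disjoint link blocks (real form of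
`LatticeRP.integral_mul_eq_of_dependsOn`); the two-link integrals of a kernel `f(U_a U_{a'}⁻¹)`
(`integral_kernel`, `integral_kernel_mul_left/right`, `integral_kernel_mul_mul_bounds`) and the
reduction of two-link transports to single links (`integral_transport_pair`); the one-plaquette
kernel `κ = exp(β Re tr ρ)` and **`exists_bump`**: for non-constant character and `β ≠ 0`, a
Urysohn bump `φ` at `1 ∈ G`, a radius `δ` and a sign `s = ∓1` with `|κ(x y⁻¹) - κ(1)| ≤ δ` on
`supp φ × supp φ` and `s (κ(1) - ∫κ) + δ < 0` (`κ(1) - ∫κ` has the sign of `β`). All statements are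
proved (Haar measure on a compact group is two-sided and inversion invariant, as in the tree).
-/

open MeasureTheory Complex Finset Function
open scoped ComplexOrder ENNReal

namespace Summit.QuantumFields.GaugeBoot

open Literature.MathematicalPhysics.QuantumFieldTheory
open Literature.RepresentationTheory.CompactGroups

noncomputable section

namespace DiagRPTwo

/-! ## The a priori measure on the link variables -/

section LinkMeasure

/-- The a priori (product Haar) probability measure on the link variables of the two-dimensional
torus `(ℤ/L)²` with structure group `G`. -/
abbrev linkMeasure (L : ℕ) [NeZero L] (G : Type*) [Group G] [TopologicalSpace G]
    [IsTopologicalGroup G] [CompactSpace G] [MeasurableSpace G] [BorelSpace G] :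
    Measure (GaugeConfig 2 L G) :=
  Measure.pi fun _ : Edge 2 L => haarProbability G

end LinkMeasure

/-! ## Product Haar measure on the links: change of variables and independence -/

section Haar

variable {L : ℕ} [NeZero L] {G : Type*} [Group G] [TopologicalSpace G] [IsTopologicalGroup G]
  [CompactSpace G] [MeasurableSpace G] [BorelSpace G] [SecondCountableTopology G]

/-- **Link-by-link change of variables** `U_a ↦ U_a · ψ(U)` with `ψ` blind to `U_a` (a measurable
function of the other links) leaves every integral against product Haar measure unchanged. -/
theorem integral_comp_update_mul (a : Edge 2 L) {ψ : GaugeConfig 2 L G → G} (hψ : Measurable ψ)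
    (hψa : ∀ U x, ψ (update U a x) = ψ U) {Φ : GaugeConfig 2 L G → ℝ} (hΦ : Measurable Φ) :
    ∫ U, Φ (update U a (U a * ψ U)) ∂(linkMeasure L G) = ∫ U, Φ U ∂(linkMeasure L G) := by
  have hT := Literature.MathematicalPhysics.QuantumLattice.measurePreserving_update_mul_pi
    (ι := Edge 2 L) (G := G) a hψ hψa
  have h1 : ∫ U, Φ (update U a (U a * ψ U)) ∂(linkMeasure L G) =
      ∫ U, Φ U ∂(Measure.map (fun u : Edge 2 L → G => update u a (u a * ψ u)) (linkMeasure L G)) :=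
    (integral_map hT.measurable.aemeasurable hΦ.aestronglyMeasurable).symm
  exact h1.trans (congrArg (fun ν : Measure (Edge 2 L → G) => ∫ U, Φ U ∂ν) hT.map_eq)

omit [SecondCountableTopology G] in
/-- Single-link marginal: `∫ f(U_e) dπ(U) = ∫ f dHaar`. -/
theorem integral_apply_eq (e : Edge 2 L) {f : G → ℝ} (hf : Measurable f) :
    ∫ U, f (U e) ∂(linkMeasure L G) = ∫ x, f x ∂(haarProbability G) := by
  have hev := MeasureTheory.measurePreserving_eval (fun _ : Edge 2 L => haarProbability G) e
  have h1 : ∫ U, f (U e) ∂(linkMeasure L G) = ∫ x, f x ∂(Measure.map (Function.eval e) (linkMeasure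
      L G)) :=
    (integral_map hev.measurable.aemeasurable hf.aestronglyMeasurable).symm
  exact h1.trans (congrArg (fun ν : Measure G => ∫ x, f x ∂ν) hev.map_eq)

omit [SecondCountableTopology G] in
/-- **Independence of disjoint link blocks** (real-valued version of
`LatticeRP.integral_mul_eq_of_dependsOn`). -/
theorem integral_mul_eq_of_dependsOn_real (S T : Finset (Edge 2 L)) (hST : Disjoint S T)
    {f g : GaugeConfig 2 L G → ℝ} (hf : Measurable f) (hg : Measurable g)
    (hfS : DependsOn f (S : Set (Edge 2 L))) (hgT : DependsOn g (T : Set (Edge 2 L))) :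
    ∫ U, f U * g U ∂(linkMeasure L G) = (∫ U, f U ∂(linkMeasure L G)) * ∫ U, g U ∂(linkMeasure L G)
        := by
  have h : ∫ U, (f U : ℂ) * (g U : ℂ) ∂(linkMeasure L G) = (∫ U, (f U : ℂ) ∂(linkMeasure L G)) * ∫
      U, (g U : ℂ) ∂(linkMeasure L G) :=
    LatticeRP.integral_mul_eq_of_dependsOn (haarProbability G) S T hST
      (f := fun U => (f U : ℂ)) (g := fun U => (g U : ℂ)) (measurable_ofReal.comp hf)
      (measurable_ofReal.comp hg) (fun U V hUV => by simp only [hfS hUV])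
      (fun U V hUV => by simp only [hgT hUV])
  simp only [← ofReal_mul, integral_complex_ofReal] at h
  exact_mod_cast h

omit [SecondCountableTopology G] in
/-- Bounded measurable functions are integrable for the product Haar probability measure. -/
theorem integrable_of_abs_le {f : GaugeConfig 2 L G → ℝ} (hf : Measurable f) {B : ℝ}
    (hB : ∀ U, |f U| ≤ B) : Integrable f (linkMeasure L G) :=
  Integrable.of_bound hf.aestronglyMeasurable B
    (ae_of_all _ fun U => by rw [Real.norm_eq_abs]; exact hB U)

end Haar

/-! ## Two-link integrals: the kernel `f(U_a U_{a'}⁻¹)` against functions of `U_a`, `U_{a'}` -/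

section TwoLink

variable {L : ℕ} [NeZero L] {G : Type*} [Group G] [TopologicalSpace G] [IsTopologicalGroup G]
  [CompactSpace G] [MeasurableSpace G] [BorelSpace G] [SecondCountableTopology G]

omit [NeZero L] [Group G] [TopologicalSpace G] [IsTopologicalGroup G] [CompactSpace G]
  [MeasurableSpace G] [BorelSpace G] [SecondCountableTopology G] in
/-- A function of one link variable depends only on that link. -/
theorem dependsOn_apply_single {α : Type*} (e : Edge 2 L) (f : G → α) :
    DependsOn (fun U : GaugeConfig 2 L G => f (U e)) (({e} : Finset (Edge 2 L)) : Set (Edge 2 L)) :=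
  fun _ _ hUV => congrArg f (hUV e (by simp))

omit [SecondCountableTopology G] in
/-- `∫ f(U_a) g(U_{a'}) dπ = ∫ f · ∫ g` for distinct links. -/
theorem integral_apply_mul_apply {a a' : Edge 2 L} (haa : a ≠ a') {f g : G → ℝ}
    (hf : Measurable f) (hg : Measurable g) :
    ∫ U, f (U a) * g (U a') ∂(linkMeasure L G) = (∫ x, f x ∂(haarProbability G)) * ∫ x, g x
        ∂(haarProbability G) := by
  rw [integral_mul_eq_of_dependsOn_real {a} {a'} (Finset.disjoint_singleton.2 haa)
    (f := fun U => f (U a)) (g := fun U => g (U a'))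
    (hf.comp (measurable_pi_apply a)) (hg.comp (measurable_pi_apply a'))
    (dependsOn_apply_single a f) (dependsOn_apply_single a' g),
    integral_apply_eq a hf, integral_apply_eq a' hg]

/-- `∫ f(U_a U_{a'}⁻¹) dπ = ∫ f` (substitute `U_a ↦ U_a U_{a'}`). -/
theorem integral_kernel {a a' : Edge 2 L} (haa : a ≠ a') {f : G → ℝ} (hf : Measurable f) :
    ∫ U, f (U a * (U a')⁻¹) ∂(linkMeasure L G) = ∫ x, f x ∂(haarProbability G) := by
  have h := integral_comp_update_mul (L := L) a (ψ := fun U => U a') (measurable_pi_apply a')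
    (fun U x => by simp only [update_of_ne haa.symm]) (Φ := fun U => f (U a * (U a')⁻¹))
    (hf.comp ((measurable_pi_apply a).mul (measurable_pi_apply a').inv))
  simp only [update_self, update_of_ne haa.symm, mul_inv_cancel_right] at h
  rw [← h]
  exact integral_apply_eq a hf

/-- `∫ f(U_a U_{a'}⁻¹) g(U_{a'}) dπ = ∫ f · ∫ g` (substitute `U_a ↦ U_a U_{a'}`, then
independence). -/
theorem integral_kernel_mul_right {a a' : Edge 2 L} (haa : a ≠ a') {f g : G → ℝ}
    (hf : Measurable f) (hg : Measurable g) :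
    ∫ U, f (U a * (U a')⁻¹) * g (U a') ∂(linkMeasure L G) = (∫ x, f x ∂(haarProbability G)) * ∫ x,
        g x ∂(haarProbability G) := by
  have h := integral_comp_update_mul (L := L) a (ψ := fun U => U a') (measurable_pi_apply a')
    (fun U x => by simp only [update_of_ne haa.symm])
    (Φ := fun U => f (U a * (U a')⁻¹) * g (U a'))
    ((hf.comp ((measurable_pi_apply a).mul (measurable_pi_apply a').inv)).mul
      (hg.comp (measurable_pi_apply a')))
  simp only [update_self, update_of_ne haa.symm, mul_inv_cancel_right] at h
  rw [← h]
  exact integral_apply_mul_apply haa hf hg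

/-- `∫ f(U_a U_{a'}⁻¹) g(U_a) dπ = ∫ f · ∫ g` for an inversion-symmetric `f` (substitute
`U_{a'} ↦ U_{a'} U_a`, then independence). -/
theorem integral_kernel_mul_left {a a' : Edge 2 L} (haa : a ≠ a') {f g : G → ℝ}
    (hf : Measurable f) (hfi : ∀ x, f x⁻¹ = f x) (hg : Measurable g) :
    ∫ U, f (U a * (U a')⁻¹) * g (U a) ∂(linkMeasure L G) = (∫ x, f x ∂(haarProbability G)) * ∫ x, g
        x ∂(haarProbability G) := by
  have h := integral_comp_update_mul (L := L) a' (ψ := fun U => U a) (measurable_pi_apply a)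
    (fun U x => by simp only [update_of_ne haa])
    (Φ := fun U => f (U a * (U a')⁻¹) * g (U a))
    ((hf.comp ((measurable_pi_apply a).mul (measurable_pi_apply a').inv)).mul
      (hg.comp (measurable_pi_apply a)))
  simp only [update_self, update_of_ne haa, mul_inv_rev, mul_inv_cancel_left, hfi] at h
  rw [← h, mul_comm (∫ x, f x ∂(haarProbability G))]
  simp_rw [mul_comm (f _) (g _)]
  exact integral_apply_mul_apply haa hg hf

/-- Two-sided bound on `∫ f(U_a U_{a'}⁻¹) φ(U_a) φ(U_{a'}) dπ` when `f` is within `δ` of `κ₁` on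
`supp φ · (supp φ)⁻¹` and `0 ≤ φ ≤ 1`. -/
theorem integral_kernel_mul_mul_bounds {a a' : Edge 2 L} (haa : a ≠ a') {f φ : G → ℝ}
    (hf : Measurable f) (hφ : Measurable φ) {B : ℝ} (hfB : ∀ x, |f x| ≤ B)
    (hφ0 : ∀ x, 0 ≤ φ x) (hφ1 : ∀ x, φ x ≤ 1) {κ₁ δ : ℝ}
    (hV : ∀ x y, φ x ≠ 0 → φ y ≠ 0 → |f (x * y⁻¹) - κ₁| ≤ δ) :
    (κ₁ - δ) * (∫ x, φ x ∂(haarProbability G)) ^ 2 ≤ ∫ U, f (U a * (U a')⁻¹) * (φ (U a) * φ (U a'))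
        ∂(linkMeasure L G) ∧
      ∫ U, f (U a * (U a')⁻¹) * (φ (U a) * φ (U a')) ∂(linkMeasure L G) ≤ (κ₁ + δ) * (∫ x, φ x
          ∂(haarProbability G)) ^ 2 := by
  have hprod : ∫ U, φ (U a) * φ (U a') ∂(linkMeasure L G) = (∫ x, φ x ∂(haarProbability G)) ^ 2 :=
      by
    rw [integral_apply_mul_apply haa hφ hφ, sq]
  have hmeasφφ : Measurable fun U : GaugeConfig 2 L G => φ (U a) * φ (U a') :=
    (hφ.comp (measurable_pi_apply a)).mul (hφ.comp (measurable_pi_apply a'))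
  have hmeas : Measurable fun U : GaugeConfig 2 L G => f (U a * (U a')⁻¹) * (φ (U a) * φ (U a')) :=
    (hf.comp ((measurable_pi_apply a).mul (measurable_pi_apply a').inv)).mul hmeasφφ
  have hφφb : ∀ U : GaugeConfig 2 L G, |φ (U a) * φ (U a')| ≤ 1 := fun U => by
    rw [abs_mul, abs_of_nonneg (hφ0 _), abs_of_nonneg (hφ0 _)]
    nlinarith [hφ0 (U a), hφ0 (U a'), hφ1 (U a), hφ1 (U a')]
  have hint1 : ∀ c : ℝ, Integrable (fun U : GaugeConfig 2 L G => c * (φ (U a) * φ (U a')))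
      (linkMeasure L G) :=
    fun c => (Integrable.of_bound hmeasφφ.aestronglyMeasurable 1
      (ae_of_all _ fun U => by rw [Real.norm_eq_abs]; exact hφφb U)).const_mul c
  have hint2 : Integrable (fun U : GaugeConfig 2 L G =>
      f (U a * (U a')⁻¹) * (φ (U a) * φ (U a'))) (linkMeasure L G) := by
    refine Integrable.of_bound hmeas.aestronglyMeasurable B (ae_of_all _ fun U => ?_)
    rw [Real.norm_eq_abs, abs_mul]
    calc |f (U a * (U a')⁻¹)| * |φ (U a) * φ (U a')| ≤ B * 1 :=
          mul_le_mul (hfB _) (hφφb U) (abs_nonneg _) ((abs_nonneg _).trans (hfB 1))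
      _ = B := mul_one B
  have hpt : ∀ U : GaugeConfig 2 L G,
      (κ₁ - δ) * (φ (U a) * φ (U a')) ≤ f (U a * (U a')⁻¹) * (φ (U a) * φ (U a')) ∧
        f (U a * (U a')⁻¹) * (φ (U a) * φ (U a')) ≤ (κ₁ + δ) * (φ (U a) * φ (U a')) := by
    intro U
    by_cases h0 : φ (U a) = 0
    · simp [h0]
    by_cases h0' : φ (U a') = 0
    · simp [h0']
    have hp : 0 ≤ φ (U a) * φ (U a') := mul_nonneg (hφ0 _) (hφ0 _)
    obtain ⟨h1, h2⟩ := abs_le.1 (hV _ _ h0 h0')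
    constructor <;> nlinarith
  constructor
  · calc (κ₁ - δ) * (∫ x, φ x ∂(haarProbability G)) ^ 2 = ∫ U, (κ₁ - δ) * (φ (U a) * φ (U a'))
      ∂(linkMeasure L G) := by
          rw [integral_const_mul, hprod]
      _ ≤ _ := integral_mono (hint1 _) hint2 fun U => (hpt U).1
  · calc ∫ U, f (U a * (U a')⁻¹) * (φ (U a) * φ (U a')) ∂(linkMeasure L G)
          ≤ ∫ U, (κ₁ + δ) * (φ (U a) * φ (U a')) ∂(linkMeasure L G) := integral_mono hint2 (hint1
              _) fun U => (hpt U).2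
      _ = (κ₁ + δ) * (∫ x, φ x ∂(haarProbability G)) ^ 2 := by rw [integral_const_mul, hprod]

/-- **Reduction of the transports to single links**: for distinct links, `U_a U_b` and
`U_{a'} U_{b'}` may be replaced by `U_a` and `U_{a'}` (substitute `U_a ↦ U_a U_b`,
`U_{a'} ↦ U_{a'} U_{b'}`). -/
theorem integral_transport_pair {a b a' b' : Edge 2 L} (hba : b ≠ a) (ha'a : a' ≠ a)
    (hb'a : b' ≠ a) (hb'a' : b' ≠ a') {Ψ : G → G → ℝ} (hΨ : Measurable fun p : G × G => Ψ p.1 p.2) :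
    ∫ U, Ψ (U a * U b) (U a' * U b') ∂(linkMeasure L G) = ∫ U, Ψ (U a) (U a') ∂(linkMeasure L G) :=
        by
  have hm1 : Measurable fun U : GaugeConfig 2 L G => Ψ (U a) (U a' * U b') := by
    have h0 : Measurable fun U : GaugeConfig 2 L G => (U a, U a' * U b') :=
      (measurable_pi_apply a).prodMk ((measurable_pi_apply a').mul (measurable_pi_apply b'))
    simpa only [Function.comp_def] using hΨ.comp h0
  have hm2 : Measurable fun U : GaugeConfig 2 L G => Ψ (U a) (U a') := by
    have h0 : Measurable fun U : GaugeConfig 2 L G => (U a, U a') :=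
      (measurable_pi_apply a).prodMk (measurable_pi_apply a')
    simpa only [Function.comp_def] using hΨ.comp h0
  have h1 := integral_comp_update_mul (L := L) a (ψ := fun U => U b) (measurable_pi_apply b)
    (fun U x => by simp only [update_of_ne hba]) hm1
  simp only [update_self, update_of_ne ha'a, update_of_ne hb'a] at h1
  have h2 := integral_comp_update_mul (L := L) a' (ψ := fun U => U b') (measurable_pi_apply b')
    (fun U x => by simp only [update_of_ne hb'a']) hm2
  simp only [update_self, update_of_ne ha'a.symm] at h2
  rw [h1, h2]

end TwoLink

/-! ## The one-plaquette kernel `κ = exp(β Re tr ρ)` and the bump function -/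

section Kernel

variable {G : Type*} [Group G] {N : ℕ} (ρ : G →* Matrix (Fin N) (Fin N) ℂ)

/-- `κ(x) = exp(β Re tr ρ(x))`, the Boltzmann factor of one plaquette (up to `e^{-βN}`). -/
def κ (β : ℝ) (x : G) : ℝ := Real.exp (β * ((ρ x).trace).re)

/-- `κ > 0`. -/
theorem κ_pos (β : ℝ) (x : G) : 0 < κ ρ β x := Real.exp_pos _

/-- `κ(1) = e^{βN}`. -/
theorem κ_one (β : ℝ) : κ ρ β 1 = Real.exp (β * N) := by
  simp [κ, Matrix.trace_one]

variable [TopologicalSpace G]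

/-- `κ` is continuous. -/
theorem continuous_κ (hρ : Continuous ρ) (β : ℝ) : Continuous (κ ρ β) :=
  (continuous_const.mul (Complex.continuous_re.comp (hρ.matrix_trace))).rexp

variable [IsTopologicalGroup G] [CompactSpace G]

/-- `κ(x⁻¹) = κ(x)` (characters of compact groups: `Re tr ρ(x⁻¹) = Re tr ρ(x)`). -/
theorem κ_inv (hρ : Continuous ρ) (β : ℝ) (x : G) : κ ρ β x⁻¹ = κ ρ β x := by
  rw [κ, κ, CompactGroup.re_trace_map_inv ρ hρ]

/-- `e^{-|β| N} ≤ κ ≤ e^{|β| N}`; in particular `|κ| ≤ e^{|β| N}`. -/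
theorem abs_κ_le (hρ : Continuous ρ) (β : ℝ) (x : G) : |κ ρ β x| ≤ Real.exp (|β| * N) := by
  rw [abs_of_pos (κ_pos ρ β x), κ, Real.exp_le_exp]
  have h := abs_le.1 (by simpa using CompactGroup.abs_re_trace_le_card ρ hρ x :
    |((ρ x).trace).re| ≤ (N : ℝ))
  calc β * ((ρ x).trace).re ≤ |β * ((ρ x).trace).re| := le_abs_self _
    _ = |β| * |((ρ x).trace).re| := abs_mul _ _
    _ ≤ |β| * N := mul_le_mul_of_nonneg_left (abs_le.2 h) (abs_nonneg β)

variable [MeasurableSpace G] [BorelSpace G]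

/-- A continuous non-negative function on the compact group which is positive somewhere has positive
Haar integral. -/
theorem integral_pos_of_continuous {f : G → ℝ} (hf : Continuous f) (h0 : ∀ x, 0 ≤ f x) {B : ℝ}
    (hB : ∀ x, f x ≤ B) {x₀ : G} (hx₀ : 0 < f x₀) : 0 < ∫ x, f x ∂(haarProbability G) := by
  have hint : Integrable f (haarProbability G) :=
    Integrable.of_bound hf.measurable.aestronglyMeasurable B
      (ae_of_all _ fun x => by rw [Real.norm_eq_abs, abs_of_nonneg (h0 x)]; exact hB x)
  rw [integral_pos_iff_support_of_nonneg h0 hint]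
  have hO : IsOpen (f ⁻¹' Set.Ioi 0) := isOpen_Ioi.preimage hf
  exact lt_of_lt_of_le (hO.measure_pos (haarProbability G) ⟨x₀, hx₀⟩)
    (measure_mono fun x (hx : 0 < f x) => hx.ne')

/-- **The bump and the sign.** If the character of `ρ` is not constant and `β ≠ 0`, there are a
continuous `φ : G → [0, 1]` with `∫ φ > 0`, a radius `δ` and a sign `s = ∓1` such that
`κ(x y⁻¹)` is within `δ` of `κ(1)` whenever `φ x ≠ 0 ≠ φ y`, and `s (κ(1) - ∫κ) + δ < 0`
(`κ(1) - ∫ κ` has the sign of `β` and `δ` is half its size). -/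
theorem exists_bump [T2Space G] (hρ : Continuous ρ) (hρN : ∃ g, ((ρ g).trace).re ≠ N) {β : ℝ}
    (hβ : β ≠ 0) :
    ∃ (φ : G → ℝ) (δ s : ℝ), Continuous φ ∧ (∀ x, 0 ≤ φ x) ∧ (∀ x, φ x ≤ 1) ∧
      (s = 1 ∨ s = -1) ∧ 0 < ∫ x, φ x ∂(haarProbability G) ∧
      (∀ x y, φ x ≠ 0 → φ y ≠ 0 → |κ ρ β (x * y⁻¹) - κ ρ β 1| ≤ δ) ∧
      s * (κ ρ β 1 - ∫ x, κ ρ β x ∂(haarProbability G)) + δ < 0 := by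
  obtain ⟨g₀, hg₀⟩ := hρN
  have htr_le : ∀ x, ((ρ x).trace).re ≤ N := fun x =>
    (abs_le.1 (by simpa using CompactGroup.abs_re_trace_le_card ρ hρ x :
      |((ρ x).trace).re| ≤ (N : ℝ))).2
  have hg₀' : ((ρ g₀).trace).re < N := lt_of_le_of_ne (htr_le g₀) hg₀
  have hcont_tr : Continuous fun x => ((ρ x).trace).re :=
    Complex.continuous_re.comp hρ.matrix_trace
  -- `κ(1) - ∫ κ` is non-zero, with the sign of `β`
  have hne : κ ρ β 1 - ∫ x, κ ρ β x ∂(haarProbability G) ≠ 0 := by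
    rcases hβ.lt_or_gt with hneg | hpos
    · -- β < 0: κ ≥ κ(1) with strict inequality at g₀
      have hpt : ∀ x, 0 ≤ κ ρ β x - κ ρ β 1 := fun x => by
        rw [κ_one, κ, sub_nonneg, Real.exp_le_exp]
        nlinarith [htr_le x]
      have hpos' : 0 < ∫ x, κ ρ β x - κ ρ β 1 ∂(haarProbability G) :=
        integral_pos_of_continuous ((continuous_κ ρ hρ β).sub continuous_const) hpt
          (B := Real.exp (|β| * N) + |κ ρ β 1|)
          (fun x => by linarith [(abs_le.1 (abs_κ_le ρ hρ β x)).2, neg_abs_le (κ ρ β 1)])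
          (x₀ := g₀) (by rw [κ_one, κ, sub_pos, Real.exp_lt_exp]; nlinarith)
      rw [integral_sub ((continuous_κ ρ hρ β).measurable |> fun h =>
          Integrable.of_bound h.aestronglyMeasurable _ (ae_of_all _ fun x => by
            rw [Real.norm_eq_abs]; exact abs_κ_le ρ hρ β x)) (integrable_const _),
        integral_const, smul_eq_mul, probReal_univ, one_mul] at hpos'
      linarith
    · -- β > 0: κ ≤ κ(1) with strict inequality at g₀
      have hpt : ∀ x, 0 ≤ κ ρ β 1 - κ ρ β x := fun x => by
        rw [κ_one, κ, sub_nonneg, Real.exp_le_exp]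
        nlinarith [htr_le x]
      have hpos' : 0 < ∫ x, κ ρ β 1 - κ ρ β x ∂(haarProbability G) :=
        integral_pos_of_continuous (continuous_const.sub (continuous_κ ρ hρ β)) hpt
          (B := |κ ρ β 1| + Real.exp (|β| * N))
          (fun x => by linarith [(abs_le.1 (abs_κ_le ρ hρ β x)).1, le_abs_self (κ ρ β 1)])
          (x₀ := g₀) (by rw [κ_one, κ, sub_pos, Real.exp_lt_exp]; nlinarith)
      rw [integral_sub (integrable_const _) ((continuous_κ ρ hρ β).measurable |> fun h =>
          Integrable.of_bound h.aestronglyMeasurable _ (ae_of_all _ fun x => by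
            rw [Real.norm_eq_abs]; exact abs_κ_le ρ hρ β x)),
        integral_const, smul_eq_mul, probReal_univ, one_mul] at hpos'
      linarith
  -- the radius and the sign
  set D : ℝ := κ ρ β 1 - ∫ x, κ ρ β x ∂(haarProbability G) with hD
  set δ : ℝ := |D| / 2 with hδ
  have hδpos : 0 < δ := by positivity
  set s : ℝ := if 0 < D then -1 else 1 with hs
  have hsD : s * D + δ < 0 := by
    rcases hne.lt_or_gt with hlt | hgt
    · rw [hs, if_neg (not_lt.2 hlt.le), hδ, abs_of_neg hlt]; linarith
    · rw [hs, if_pos hgt, hδ, abs_of_pos hgt]; linarith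
  -- the neighbourhood `V` of `1` with `V · V⁻¹ ⊆ {|κ - κ(1)| < δ}`
  set O : Set (G × G) := {p | |κ ρ β (p.1 * p.2⁻¹) - κ ρ β 1| < δ} with hO
  have hOopen : IsOpen O := by
    have hc : Continuous fun p : G × G => |κ ρ β (p.1 * p.2⁻¹) - κ ρ β 1| :=
      (((continuous_κ ρ hρ β).comp (continuous_fst.mul continuous_snd.inv)).sub
        continuous_const).abs
    exact isOpen_Iio.preimage hc
  have h11 : ((1 : G), (1 : G)) ∈ O := by
    show |κ ρ β (1 * 1⁻¹) - κ ρ β 1| < δ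
    simpa using hδpos
  obtain ⟨u, v, hu, hv, h1u, h1v, huv⟩ := isOpen_prod_iff.1 hOopen 1 1 h11
  set V : Set G := u ∩ v with hV
  have hVopen : IsOpen V := hu.inter hv
  have h1V : (1 : G) ∈ V := ⟨h1u, h1v⟩
  -- Urysohn bump: `φ = 1` at `1`, `φ = 0` off `V`
  obtain ⟨φ, hφ0, hφ1, hφ01⟩ := exists_continuous_zero_one_of_isClosed
    (isClosed_compl_iff.2 hVopen) (isClosed_singleton (x := (1 : G)))
    (Set.disjoint_singleton_right.2 fun h => h h1V)
  have hφV : ∀ x, φ x ≠ 0 → x ∈ V := fun x hx => by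
    by_contra hxV
    exact hx (hφ0 hxV)
  refine ⟨φ, δ, s, φ.continuous, fun x => (hφ01 x).1, fun x => (hφ01 x).2, ?_, ?_, ?_, hsD⟩
  · rw [hs]; split_ifs <;> simp
  · exact integral_pos_of_continuous φ.continuous (fun x => (hφ01 x).1) (B := 1)
      (fun x => (hφ01 x).2) (x₀ := 1) (by rw [hφ1 rfl]; exact one_pos)
  · intro x y hx hy
    have hxy : (x, y) ∈ O := huv (Set.mk_mem_prod (hφV x hx).1 (hφV y hy).2)
    exact le_of_lt hxy

end Kernel

end DiagRPTwo

end

end Summit.QuantumFields.GaugeBoot
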